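import Literature.MathematicalPhysics.QuantumFieldTheory.Balaban1983to89.B6SectALemma24OneLevelV1
import Literature.MathematicalPhysics.QuantumFieldTheory.Balaban1983to89.B9LocalGaugeZeroModesY
import Literature.MathematicalPhysics.QuantumFieldTheory.Balaban1983to89.B6AgreeQaQV1Chart
import Literature.MathematicalPhysics.QuantumFieldTheory.Balaban1983to89.Node00.OpsYQOnto

/-!
# `Balaban1983to89.B9LocalLemma24AtLettersY` — T. Bałaban, *Propagators and renormalization transformations for lattice gauge theories. II*,
# Commun. Math. Phys. **96** (1984) 223–250 [Balaban1984PropagatorsII], Lemma 2.4 (2.128) p. 245 LOCALISED AT A ONE-LEVEL CUBE and read on def-Y's box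
# kernels: **`κ·Σ_b v(b)² ≤ Σ_p ((curlK·v)(p))² + Σ_ι w(ι)·((qK·v)(ι))²` for every real bond field `v` axially gauged on the cube's blocks and vanishing off
# the cube** — the LOCAL LEMMA-2.4 LETTER (Rᴸ²⁴) of row 17's centre number `m_□` ([B9] Thm 3.11's local road), for one-level cubes with non-deeper neighbours

T. Bałaban, *Propagators for lattice gauge theories in a background field*, Commun. Math. Phys. **99** (1985) 389–434 [Balaban1985BackgroundPropagators] p. 416;
[4] = [Balaban1984PropagatorsII].  Statement-level skeleton with citation tags; proofs where landed; nothing here is a claim about the Yang–Mills mass gap.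

THE PRINT (verbatim).  [Balaban1984PropagatorsII] p. 245, Lemma 2.4 (2.128): *«L^{d−2} Σ_{c∈Λ′} |(Q₁B)(c)|² + Σ_p |(∂₁B)(p)|² ≥ (1∕(12d²)) L^{−d−1} ‖B‖²»* for `B`
in the gauge (2.121) *«B(b) = 0 for b ⊂ Γ_{y,x}, x ∈ B(y), y ∈ Λ′»*; p. 239: *«otherwise the operator G_□ is simply equal to the operator G_j on the torus T_□.
These operators were thoroughly investigated in paper [4]»* (the one-level cube).

WHY THIS FILE (cell context, 2026-08-28).  Row 17's local centre number is reduced (this seat, g24: `…LocalCentreCoerciveReduction`, `…LettersOfRealLetters`,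
`B9Eq211PoincareAtLettersY`, `B9LocalAxialDecompositionY`, composed in `…LocalCentreOfLemma24Letter`) to ONE real letter, the local Lemma 2.4 (Rᴸ²⁴) on the class
`𝒯ᵣ(D)` = «staircase sums from the block corners vanish on every block inside `D`; zero on bonds with both ends off `D`».  dag-n10-c's ROAD «C» station C4
(`B6SectALemma24OneLevelV1`) carried pv09's torus Lemma 2.4 to the V1 carriers for configurations gauged on EVERY block of one level.  THIS FILE localises C4
(census v22.1 §1: *one-level cubes with non-deeper neighbours*): §1 the tree condition (2.121) BLOCK BY BLOCK (`liftB_eq_zero_of_treeBond_block`, C4's argument per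
block; `ends_mem_iterBlock_of_treeBond`); §2 ★ `lemma24_oneLevel_V1_local` — Lemma 2.4 on the level-`k` torus for `B` gauged on the blocks of a set `S` and
VANISHING inside every other block (tree bonds lie inside their block); §3 ★★★ `local_lemma24_real` — at def-Y's box: for `D` a union of level-`j` blocks whose blocks
are member blocks (`Λ_j`-sites) and whose NEIGHBOURING level-`j` bonds are member index bonds (`hNbr`: every level-`j` bond one of whose end blocks meets `D` is a
`LamBond` — «non-deeper neighbours»), weights `≥ w₀` on the level-`j` index bonds, every `v ∈ 𝒯ᵣ(D)` satisfies
**`κ_j·Σ v² ≤ Σ (curlK·v)² + Σ_ι w(ι)(qK·v)(ι)²`, `κ_j = (1∕(12(d+1)²))·((Lʲ)^{d+2})⁻¹·min(c_f², w₀∕(Lʲ)^{d−1})`** — C4's `lemma24_torus` transport + the Q-domination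
(non-index level-`j` bonds see no bond touching `D`: `B6AgreeQaQV1Chart.bondAvgIter_eq_zero_of_local`; index bonds inject into `𝔅`).
HONEST SCOPE.  Transport of landed kernel theorems (pv09 ∕ C4); the cube hypotheses (`hDj`, `hDLam`, `hNbr`, the weight floor) are DISPLAYED geometric facts about the
cube, not proved here; constants ours; NOT a node discharge; count-neutral; one finite 𝕋⁴ programme — nothing about the mass gap.  Cell `pub-ymgap` (D-0062), node N06
[B9] × N10 ROAD «C», seat `pub-ymgap-dag-n06-j` gen 24, 2026-08-28.  No `sorry`∕`axiom`∕`instance`∕`def`.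
-/

open scoped InnerProductSpace

namespace Literature.MathematicalPhysics.QuantumFieldTheory.Balaban1983to89.B9LocalLemma24AtLettersY

open Literature.MathematicalPhysics.QuantumFieldTheory.Balaban1983to89
open LatticeFieldCalculus B5Eq118OneStroke B5Eq120IterProof B6SectADomainsV1 B6SectAOperatorsV1
open Literature.MathematicalPhysics.QuantumFieldTheory.BalabanImbrieJaffe1984to88.BIJ85AxialPropagator411 (BondSpace)
open Literature.MathematicalPhysics.QuantumFieldTheory.Balaban1983to89.B6Lemma24Torus (IsPeriodic pbox mem_pbox coarseSites mem_coarseSites normSqT d1SqT q1SqT lemma24_torus)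
open Literature.MathematicalPhysics.QuantumFieldTheory.Balaban1983to89.B6BondElimination (treeBonds mem_treeBonds add_smul_unitVec_apply unitVec_apply)
open Literature.MathematicalPhysics.QuantumFieldTheory.Balaban1983to89.B6SectALemma24OneLevelV1 (castZ toZ liftB cornerV1 periodV1 castZ_toZ castZ_mem_iterBlock_of_mem_block
  castZ_add_unitVec pow_le_half_sitesPerDir stairSum_shift_eq_add exists_eq_toZ_cornerV1 sitesPerDir_zero_eq_mul isPeriodic_liftB normSqT_liftB q1SqT_liftB
  d1SqT_liftB)
open Literature.MathematicalPhysics.QuantumFieldTheory.Balaban1983to89.B6AgreeQaQV1Chart (bondAvgIter_eq_zero_of_local)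

noncomputable section

/-! ## §1 The tree condition (2.121) block by block -/

section Tree

variable {P : Params} {k : ℕ}

/-- the two end points of a tree bond of the block `Bᵏ(yk)` lie in `Bᵏ(yk)`. [cite: Balaban1984PropagatorsII, (2.121) p.244; Balaban1984PropagatorsI, (1.7) p.18, bookkeeping] -/
theorem ends_mem_iterBlock_of_treeBond (hk : k ≤ P.m + P.K) (yk : Site P k) {b : (Fin P.d → ℤ) × Fin P.d}
    (hb : b ∈ treeBonds (P.L ^ k) (toZ (cornerV1 k yk))) :
    castZ (P := P) b.1 ∈ iterBlock k yk ∧ (castZ (P := P) b.1).shift b.2 ∈ iterBlock k yk := by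
  obtain ⟨hw, -, hlast⟩ := mem_treeBonds.1 hb
  refine ⟨castZ_mem_iterBlock_of_mem_block hk yk hw, ?_⟩
  have hw' : b.1 + B6BondElimination.unitVec b.2 ∈ B6Elimination.block (P.L ^ k) (toZ (cornerV1 k yk)) := by
    refine B6Elimination.mem_block.2 fun i => ?_
    obtain ⟨h0, h1⟩ := B6Elimination.mem_block.1 hw i
    rw [show b.1 + B6BondElimination.unitVec b.2 = b.1 + (1 : ℤ) • B6BondElimination.unitVec b.2 by rw [one_smul], add_smul_unitVec_apply]
    by_cases h : i = b.2
    · subst h; rw [if_pos rfl]; constructor <;> omega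
    · rw [if_neg h]; constructor <;> omega
  rw [← castZ_add_unitVec]; exact castZ_mem_iterBlock_of_mem_block hk yk hw'

/-- ★ **(2.121) bond-wise ON ONE BLOCK**: if the staircase sums of `B` from the corner of `Bᵏ(yk)` vanish on `Bᵏ(yk)`, then `B^ℤ` vanishes on every bond of b06's tree of
that block (C4's `liftB_eq_zero_of_treeBond`, per block). [cite: Balaban1984PropagatorsII, (2.121) p.244; Balaban1984PropagatorsI, (1.7) p.18] -/
theorem liftB_eq_zero_of_treeBond_block (hk : k ≤ P.m + P.K) (B : BondSpace P) (yk : Site P k)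
    (hT : ∀ x ∈ iterBlock k yk, stairSum (WithLp.ofLp B) (cornerV1 k yk) x = 0) :
    ∀ b ∈ treeBonds (P.L ^ k) (toZ (cornerV1 k yk)), liftB B b = 0 := by
  intro b hb
  obtain ⟨hx, hx'⟩ := ends_mem_iterBlock_of_treeBond hk yk hb
  obtain ⟨hw, hpre, hlast⟩ := mem_treeBonds.1 hb
  obtain ⟨h0, h1⟩ := B6Elimination.mem_block.1 hw b.2
  set t : ℕ := (b.1 b.2 - toZ (cornerV1 k yk) b.2).toNat with htdef
  have ht0 : (t : ℤ) = b.1 b.2 - toZ (cornerV1 k yk) b.2 := Int.toNat_of_nonneg (by omega)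
  have htn : t + 1 + 1 ≤ P.L ^ k := by zify; rw [ht0]; push_cast at hlast ⊢; omega
  have ht1 : t + 1 ≤ P.sitesPerDir 0 / 2 := le_trans (by omega) (pow_le_half_sitesPerDir hk)
  have hcμ : (castZ (P := P) b.1) b.2 - cornerV1 k yk b.2 = ((t : ℕ) : ZMod (P.sitesPerDir 0)) := by
    have hc : cornerV1 k yk b.2 = castZ (toZ (cornerV1 k yk)) b.2 := by rw [castZ_toZ]
    rw [hc]
    simp only [castZ]
    rw [← Int.cast_sub, ← ht0, Int.cast_natCast]
  have ht : ((castZ (P := P) b.1) b.2 - cornerV1 k yk b.2).valMinAbs = t := by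
    rw [hcμ, ZMod.valMinAbs_natCast_of_le_half (le_trans (Nat.le_succ t) ht1)]
  have hpre' : ∀ ν, ν < b.2 → (castZ (P := P) b.1) ν = cornerV1 k yk ν := by
    intro ν hν
    have hc : cornerV1 k yk ν = castZ (toZ (cornerV1 k yk)) ν := by rw [castZ_toZ]
    rw [hc]; simp only [castZ, hpre ν hν]
  have hstep := stairSum_shift_eq_add (WithLp.ofLp B) (cornerV1 k yk) (castZ b.1) b.2 hpre' ht ht1
  rw [hT _ hx, hT _ hx', zero_add] at hstep
  show WithLp.ofLp B ⟨castZ b.1, b.2⟩ = 0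
  exact hstep.symm

end Tree

/-! ## §2 ★ Lemma 2.4 on the level-`k` torus for configurations gauged on some blocks and vanishing inside the others -/

section Torus

variable {P : Params} {k : ℕ}

/-- ★ **LEMMA 2.4 (2.128) ON `T^{(0)}`, BLOCKS OF ORDER `k`, LOCAL FORM**: for `d ≥ 2`, `k ≤ m + K`, a set `S` of blocks and a configuration `B` whose staircase sums from
the corner vanish on every block of `S` and which VANISHES on every bond inside every block not in `S` (then (2.121) holds on all blocks: the tree bonds of a block lie
inside it), `(1∕(12d²))·((Lᵏ)^{d+1})⁻¹·‖B‖² ≤ (Lᵏ)^{d−2}·Σ_{b̄∈T^{(k)}} |(Q_kB)(b̄)|² + Σ_{p⊂T^{(0)}} |(∂B)(p)|²` — pv09's `lemma24_torus` through C4's transport.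
[cite: Balaban1984PropagatorsII, Lemma 2.4 (2.128) p.245, (2.121) p.244, (2.153) p.249; Balaban1984PropagatorsI, (1.18) p.20] -/
theorem lemma24_oneLevel_V1_local (hd : 2 ≤ P.d) (hk : k ≤ P.m + P.K) (B : BondSpace P) (S : Set (Site P k))
    (hT : ∀ yk ∈ S, ∀ x ∈ iterBlock k yk, stairSum (WithLp.ofLp B) (cornerV1 k yk) x = 0)
    (hoff : ∀ yk, yk ∉ S → ∀ b : PBond P 0, b.src ∈ iterBlock k yk → b.tgt ∈ iterBlock k yk → WithLp.ofLp B b = 0) :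
    1 / (12 * (P.d : ℝ) ^ 2) * (((P.L : ℝ) ^ k) ^ (P.d + 1))⁻¹ * ‖B‖ ^ 2 ≤
      ((P.L : ℝ) ^ k) ^ (P.d - 2) * ∑ b : PBond P k, bondAvgIter k (WithLp.ofLp B) b ^ 2 +
        ∑ p : Plaq P 0, LatticeFieldCalculus.curl 1 (WithLp.ofLp B) p ^ 2 := by
  classical
  have hn : 1 ≤ P.L ^ k := Nat.one_le_pow _ _ P.L_pos
  have hM : ∀ i : Fin P.d, 0 < periodV1 P i := fun _ => Nat.pos_of_ne_zero (P.sitesPerDir_ne_zero 0)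
  have hLM : ∀ i : Fin P.d, P.L ^ k ∣ periodV1 P i := fun _ => by
    show P.L ^ k ∣ P.sitesPerDir 0
    rw [sitesPerDir_zero_eq_mul hk]; exact Dvd.intro_left _ rfl
  have hT' : ∀ y ∈ coarseSites (P.L ^ k) (periodV1 P), ∀ b ∈ treeBonds (P.L ^ k) y, liftB B b = 0 := by
    intro y hy b hb
    obtain ⟨yk, rfl⟩ := exists_eq_toZ_cornerV1 hk hy
    by_cases hS : yk ∈ S
    · exact liftB_eq_zero_of_treeBond_block hk B yk (hT yk hS) b hb
    · obtain ⟨h1, h2⟩ := ends_mem_iterBlock_of_treeBond hk yk hb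
      exact hoff yk hS ⟨castZ b.1, b.2⟩ h1 h2
  have h := lemma24_torus hd hn hM hLM (liftB B) (isPeriodic_liftB B) hT'
  rw [normSqT_liftB, q1SqT_liftB hk, d1SqT_liftB] at h
  have hLr : (0 : ℝ) ≤ ((P.L ^ k : ℕ) : ℝ) := Nat.cast_nonneg _
  have e1 : ((P.L ^ k : ℕ) : ℝ) ^ (-((P.d : ℝ) + 1)) = (((P.L : ℝ) ^ k) ^ (P.d + 1))⁻¹ := by
    rw [Real.rpow_neg hLr, ← Nat.cast_succ, Real.rpow_natCast]; push_cast; rfl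
  have e2 : ((P.L ^ k : ℕ) : ℝ) ^ ((P.d : ℝ) - 2) = ((P.L : ℝ) ^ k) ^ (P.d - 2) := by
    have h2 : ((P.d - 2 : ℕ) : ℝ) = (P.d : ℝ) - 2 := by rw [Nat.cast_sub hd]; norm_num
    rw [← h2, Real.rpow_natCast]; push_cast; rfl
  rw [e1, e2] at h
  exact h

end Torus

/-! ## §3 ★★★ The local Lemma-2.4 letter at def-Y's box kernels -/

section DefY

open Node00 B6KLevelCensusIndexV1 B6GlobalChartV1 B6Ineq2133TwoScaleV1
open Literature.MathematicalPhysics.QuantumFieldTheory.Balaban1983to89.B9LocalGaugeZeroModesY (curlK_mulVec)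
open Literature.MathematicalPhysics.QuantumFieldTheory.Balaban1983to89.Node00.OpsYNablaBridge (chartY)
open scoped Matrix

variable {d ℓ : ℕ} {hd : 1 ≤ d + 1} {hL : Odd (ℓ + 1) ∧ 1 < ℓ + 1} {b₀ b₁ : ℝ} (i : KIdx d ℓ hd hL b₀ b₁)

/-- the entries of `curlK·v` are `c_f`-multiples of the unit-factor circulations. [cite: Balaban1985BackgroundPropagators, (3.4) p.391; Balaban1984PropagatorsI, (1.4) p.18, dictionary] -/
theorem curlK_mulVec_apply_eq (v : FBondY i → ℝ) (p : PlaqY i) :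
    (curlK i *ᵥ v) p = i.cf * LatticeFieldCalculus.curl 1 v p := by
  rw [curlK_mulVec]
  simp only [LatticeFieldCalculus.curl, smul_eq_mul, one_mul]

/-- ★★★ **THE LOCAL LEMMA-2.4 LETTER (Rᴸ²⁴) AT def-Y's BOX, ONE-LEVEL CUBES WITH NON-DEEPER NEIGHBOURS.**  Let `j ≤ m + K` be a level and `D` a set of box sites such that
(`hDj`) every level-`j` block lies inside or outside `D`, (`hDLam`) every level-`j` block inside `D` is a member block (`y ∈ Λ_j`), (`hNbr`) every level-`j` bond one
of whose end blocks meets `D` is a member index bond (`LamBond j`), and (`hw`) the member's weights on the level-`j` index bonds are `≥ w₀ > 0`.  Then every real bond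
field `v` with vanishing corner staircase sums on the member blocks inside `D` and vanishing on the bonds with both ends off `D` satisfies
**`κ_j·Σ_b v(b)² ≤ Σ_p ((curlK·v)(p))² + Σ_ι w(ι)·((qK·v)(ι))²`, `κ_j = (1∕(12(d+1)²))·((Lʲ)^{d+2})⁻¹·min(c_f², w₀∕(Lʲ)^{d−1})`** (`L = ℓ+1`) — the `hL24r`
hypothesis of `Summits/…/BalabanUVNodesN06Row17LocalCentreOfLemma24Letter.coer_trIP_padDeltaALocY_one_of_lemma24_letter`.
[cite: Balaban1984PropagatorsII, Lemma 2.4 (2.128) p.245, (2.121) p.244, (2.18)–(2.20) p.226, p.239 («G_□ is simply equal to the operator G_j on the torus»); Balaban1984PropagatorsI, (1.11) p.19, (1.18) p.20] -/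
theorem local_lemma24_real (hd2 : 2 ≤ d + 1) {j : ℕ} (hj : j ≤ i.m + i.K) (D : Finset (SiteY i))
    (hDj : ∀ yk : Site (PV d ℓ i.m i.K hd hL) j, (∀ x ∈ iterBlock j yk, chartY i x ∈ D) ∨ (∀ x ∈ iterBlock j yk, chartY i x ∉ D))
    (hDLam : ∀ yk : Site (PV d ℓ i.m i.K hd hL) j, (∀ x ∈ iterBlock j yk, chartY i x ∈ D) → (domT i.hN i.D i.hk).LamSite j yk)
    (hNbr : ∀ bb : PBond (PV d ℓ i.m i.K hd hL) j, ¬ (domT i.hN i.D i.hk).LamBond j bb →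
      ∀ x : Site (PV d ℓ i.m i.K hd hL) 0, (iterBlockOf j x = bb.src ∨ iterBlockOf j x = bb.tgt) → chartY i x ∉ D)
    {w₀ : ℝ} (hw₀ : 0 < w₀) (hw : ∀ ι : IBondY i, (ι.1.1 : ℕ) = j → w₀ ≤ i.w ι) (v : FBondY i → ℝ)
    (hst : ∀ (j' : ℕ) (y : Site (PV d ℓ i.m i.K hd hL) j'), (domT i.hN i.D i.hk).LamSite j' y → (∀ x ∈ iterBlock j' y, chartY i x ∈ D) →
      ∀ x ∈ iterBlock j' y, stairSum v (cornerV1 j' y) x = 0)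
    (hoff : ∀ b : FBondY i, chartY i b.src ∉ D → chartY i b.tgt ∉ D → v b = 0) :
    1 / (12 * (((d + 1 : ℕ) : ℝ)) ^ 2) * (((((ℓ + 1 : ℕ) : ℝ)) ^ j) ^ (d + 1 + 1))⁻¹ * min (i.cf ^ 2) (w₀ / ((((ℓ + 1 : ℕ) : ℝ)) ^ j) ^ (d + 1 - 2)) *
        ∑ b, v b ^ 2 ≤
      ∑ p, (curlK i *ᵥ v) p ^ 2 + ∑ ι, i.w ι * (qK i *ᵥ v) ι ^ 2 := by
  classical
  -- Lemma 2.4 on the level-`j` torus, local form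
  have h24 := lemma24_oneLevel_V1_local (P := PV d ℓ i.m i.K hd hL) hd2 hj (WithLp.toLp 2 v) {yk | ∀ x ∈ iterBlock j yk, chartY i x ∈ D}
    (fun yk hyk x hx => by rw [WithLp.ofLp_toLp]; exact hst j yk (hDLam yk hyk) hyk x hx)
    (fun yk hyk b hs ht => by
      rw [WithLp.ofLp_toLp]
      rcases hDj yk with hin | hout
      · exact absurd hin hyk
      · exact hoff b (hout _ hs) (hout _ ht))
  rw [WithLp.ofLp_toLp, EuclideanSpace.real_norm_sq_eq] at h24
  -- abbreviations
  set α : ℝ := 1 / (12 * (((d + 1 : ℕ) : ℝ)) ^ 2) * (((((ℓ + 1 : ℕ) : ℝ)) ^ j) ^ (d + 1 + 1))⁻¹ with hα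
  set nq : ℝ := ((((ℓ + 1 : ℕ) : ℝ)) ^ j) ^ (d + 1 - 2) with hnq
  set SQ : ℝ := ∑ bb : PBond (PV d ℓ i.m i.K hd hL) j, bondAvgIter j v bb ^ 2 with hSQ
  set SC : ℝ := ∑ p : Plaq (PV d ℓ i.m i.K hd hL) 0, LatticeFieldCalculus.curl 1 v p ^ 2 with hSC
  set μ : ℝ := min (i.cf ^ 2) (w₀ / nq) with hμ
  have h24' : α * ∑ b, v b ^ 2 ≤ nq * SQ + SC := h24
  have hnq0 : 0 < nq := by rw [hnq]; exact pow_pos (pow_pos (by exact_mod_cast Nat.succ_pos ℓ) _) _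
  have hSQ0 : 0 ≤ SQ := Finset.sum_nonneg fun _ _ => sq_nonneg _
  have hSC0 : 0 ≤ SC := Finset.sum_nonneg fun _ _ => sq_nonneg _
  have hμ0 : 0 ≤ μ := le_min (sq_nonneg _) (div_nonneg hw₀.le hnq0.le)
  have h1 : μ * (nq * SQ) ≤ w₀ * SQ := by
    calc μ * (nq * SQ) ≤ (w₀ / nq) * (nq * SQ) := mul_le_mul_of_nonneg_right (min_le_right _ _) (mul_nonneg hnq0.le hSQ0)
      _ = w₀ * SQ := by field_simp
  have h2 : μ * SC ≤ i.cf ^ 2 * SC := mul_le_mul_of_nonneg_right (min_le_left _ _) hSC0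
  -- the curl term
  have hcurl : ∑ p, (curlK i *ᵥ v) p ^ 2 = i.cf ^ 2 * SC := by
    rw [hSC, Finset.mul_sum]
    exact Finset.sum_congr rfl fun p _ => by rw [curlK_mulVec_apply_eq]; ring
  -- the Q-domination: non-index level-`j` bonds see no bond touching `D`; index bonds inject into `𝔅`
  have hQ : w₀ * SQ ≤ ∑ ι, i.w ι * (qK i *ᵥ v) ι ^ 2 := by
    have hzero : ∀ bb : PBond (PV d ℓ i.m i.K hd hL) j, ¬ (domT i.hN i.D i.hk).LamBond j bb → bondAvgIter j v bb = 0 := by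
      intro bb hbb
      exact bondAvgIter_eq_zero_of_local j hj v bb fun b hb1 hb2 => hoff b (hNbr bb hbb b.src hb1) (hNbr bb hbb b.tgt hb2)
    obtain ⟨T, hTdef⟩ : ∃ T : Finset (PBond (PV d ℓ i.m i.K hd hL) j), T = Finset.univ.filter fun bb => (domT i.hN i.D i.hk).LamBond j bb :=
      ⟨_, rfl⟩
    have hmemT : ∀ {bb}, bb ∈ T → (domT i.hN i.D i.hk).LamBond j bb := fun h => by rw [hTdef] at h; exact (Finset.mem_filter.1 h).2
    have hsplit : SQ = ∑ bb ∈ T, bondAvgIter j v bb ^ 2 := by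
      rw [hSQ, hTdef, Finset.sum_filter]
      refine Finset.sum_congr rfl fun bb _ => ?_
      split_ifs with h
      · rfl
      · rw [hzero bb h]; ring
    let emb : {bb // bb ∈ T} → IBondY i := fun x =>
      ⟨⟨⟨j, Nat.lt_succ_of_le ((domT i.hN i.D i.hk).le_of_lamBond (hmemT x.2))⟩, x.1⟩, hmemT x.2⟩
    have hemb : Function.Injective emb := by
      intro x x' h
      have h' := congrArg (fun ι : IBondY i => ι.1) h
      simp only [emb, Sigma.mk.inj_iff, heq_eq_eq, true_and] at h'
      exact Subtype.ext h'
    have hqe : ∀ x : {bb // bb ∈ T}, (qK i *ᵥ v) (emb x) = bondAvgIter j v x.1 := fun x => by rw [qK_mulVec]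
    calc w₀ * SQ = ∑ bb ∈ T, w₀ * bondAvgIter j v bb ^ 2 := by rw [hsplit, Finset.mul_sum]
      _ = ∑ x ∈ T.attach, w₀ * bondAvgIter j v x.1 ^ 2 := (Finset.sum_attach T fun bb => w₀ * bondAvgIter j v bb ^ 2).symm
      _ ≤ ∑ x ∈ T.attach, i.w (emb x) * (qK i *ᵥ v) (emb x) ^ 2 :=
          Finset.sum_le_sum fun x _ => by rw [hqe]; exact mul_le_mul_of_nonneg_right (hw _ rfl) (sq_nonneg _)
      _ = ∑ ι ∈ T.attach.map ⟨emb, hemb⟩, i.w ι * (qK i *ᵥ v) ι ^ 2 := by rw [Finset.sum_map]; rfl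
      _ ≤ ∑ ι, i.w ι * (qK i *ᵥ v) ι ^ 2 :=
          Finset.sum_le_sum_of_subset_of_nonneg (Finset.subset_univ _) fun ι _ _ => mul_nonneg (i.hw ι).le (sq_nonneg _)
  -- assembly
  rw [hcurl]
  calc α * μ * ∑ b, v b ^ 2 = μ * (α * ∑ b, v b ^ 2) := by ring
    _ ≤ μ * (nq * SQ + SC) := mul_le_mul_of_nonneg_left h24' hμ0
    _ = μ * (nq * SQ) + μ * SC := by ring
    _ ≤ w₀ * SQ + i.cf ^ 2 * SC := add_le_add h1 h2
    _ ≤ (∑ ι, i.w ι * (qK i *ᵥ v) ι ^ 2) + i.cf ^ 2 * SC := by linarith [hQ]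
    _ = i.cf ^ 2 * SC + ∑ ι, i.w ι * (qK i *ᵥ v) ι ^ 2 := by ring

/-- the local Lemma-2.4 constant is positive. [cite: Balaban1984PropagatorsII, Lemma 2.4 (2.128) p.245; folklore] -/
theorem local_lemma24_const_pos (j : ℕ) {w₀ : ℝ} (hw₀ : 0 < w₀) :
    0 < 1 / (12 * (((d + 1 : ℕ) : ℝ)) ^ 2) * (((((ℓ + 1 : ℕ) : ℝ)) ^ j) ^ (d + 1 + 1))⁻¹ *
      min (i.cf ^ 2) (w₀ / ((((ℓ + 1 : ℕ) : ℝ)) ^ j) ^ (d + 1 - 2)) := by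
  have hL : (0 : ℝ) < (((ℓ + 1 : ℕ) : ℝ)) ^ j := pow_pos (by exact_mod_cast Nat.succ_pos ℓ) _
  have hd' : (0 : ℝ) < (((d + 1 : ℕ) : ℝ)) := by exact_mod_cast Nat.succ_pos d
  have hmin : 0 < min (i.cf ^ 2) (w₀ / ((((ℓ + 1 : ℕ) : ℝ)) ^ j) ^ (d + 1 - 2)) :=
    lt_min (sq_pos_iff.mpr i.hcf) (div_pos hw₀ (pow_pos hL _))
  positivity

end DefY

end

end Literature.MathematicalPhysics.QuantumFieldTheory.Balaban1983to89.B9LocalLemma24AtLettersY
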